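import Summits.BirchSwinnertonDyer.Rank1Residual.X2.CongruenceTransfer
import HarnessLib

/-!
# Class X2 (odd multiplicative Eisenstein prime): ROUTE G at `p ‖ N` — the squeeze with the EXACT
# algebraic invariants: `μ_an = 0 ∧ λ_an = n ∧ (μ_alg, λ_alg) = (0, k) ∧ n ≤ k + e_p` ⇒ Mazur's main
# conjecture at `(E, p)`, and the consistency `k + e_p ≤ λ_an` (cell `b2b-bsdres`, unit
# `b2b-bsdres-eisenstein-p2`, gen 7)

HONEST FRAMING (run/shared/lean/b2b/bsd-rank1-residual/, verbatim in every file): the goal of the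
cell is to DELETE the COMBINATION-SHAPED residual classes of the Birch–Swinnerton-Dyer formula for
ALL analytic-rank `≤ 1` elliptic curves over `ℚ` — "full BSD formula for every rank `≤ 1` curve in
class `C`" assembled STRICTLY from published theorems — so that the rank-`≤ 1` remainder becomes
exactly the CONSTRUCTION-SHAPED classes, which are TYPED (missing-input `Prop`s), NOT attempted.
This is not "finishing BSD". Research routes; NO CLAIM BEYOND STATED CLASSES; nothing here changes
a label; X2b and X2c stay CONSTRUCTION-SHAPED. Theorems only (no definition, no named fact): the
published theorem enters as the tree's existing NAMED FACT Wuthrich 2014 Thm. 16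
(`thm16_charIdeal_dvd_multiplicative_of_reducible`), taken as a hypothesis, with modularity
(`nonempty_modularParametrizationData`); the per-pair data are the cell's TYPED inputs
`X2.AnalyticMuLE`, `X2.AnalyticLambdaEq` (gen 4) and `X2.AlgebraicInvariantsEq` (gen 7,
`X2/CongruenceTransfer.lean`: "`X(E/ℚ_∞)` torsion, `μ = 0`, `λ = k`", supplied per pair by the
Greenberg–Vatsal congruence transfer from a closed X1 / X2 relative).

WHY THIS FILE. Route T (`X2/TamagawaSqueeze.lean`, gen 6) closes Mazur's main conjecture at a
multiplicative Eisenstein pair from a LOWER bound `λ_alg ≥ k` valid for every cyclotomic dual datum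
(`X1.TamagawaSqueeze.AlgebraicLambdaGE`, all topological generators `γ`). Route G delivers the EXACT
value `λ_alg = k`, but only for the generators matching the cyclotomic variable (the transfer
statement `CongruentLambdaShift` and every main-conjecture statement of the cell are phrased there),
so the squeeze is re-run here against `AlgebraicInvariantsEq`: with Wuthrich's
`ϖ·L = ι(T^{e_p}·h·f_E)`, `char X = (f_E)`, one has `n = e_p + λ(h) + k`, hence (Kato–Wuthrich)
`k + e_p ≤ n` ALWAYS (`add_le_of_algebraicInvariantsEq_of_analyticLambdaEq` — the census's
falsification test: a transferred `k + e_p > λ_an` refutes an input), and `n ≤ k + e_p` forces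
`λ(h) = 0 = μ(h)`, `h ∈ Λˣ`: Mazur's main conjecture at the pair
(`mazurMainConjectureAt_of_algebraicInvariantsEq`; NO parity and NO rank hypothesis — at the exact
value parity adds nothing: `λ_an − e_p − k = λ(h)` odd would contradict `λ_an ≡ r_an + e_p`,
`λ_alg ≡ r_an`, i.e. refute an input, never close a pair).

References: [Wuthrich2014] Thm. 16, §5 (p. 397); [GreenbergVatsal2000] p. 4 and §2 p. 27;
HOME/b2b-bsdres-eisenstein-p2/X2-GAP.md §12.
-/

set_option autoImplicit false

noncomputable section

open scoped Classical MatrixGroups ModularForm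

open PowerSeries CongruenceSubgroup WeierstrassCurve Literature.NumberTheory.EllipticCurves
  Literature.NumberTheory.EllipticCurves.ModularForms
  Literature.NumberTheory.EllipticCurves.Rank1Residual
  Literature.NumberTheory.EllipticCurves.Rank1Residual.Typed
  Literature.NumberTheory.EllipticCurves.Wuthrich2014
  Summit.BirchSwinnertonDyer.Rank1Residual.X1.MuLambda
  Summit.BirchSwinnertonDyer.Rank1Residual.X1.MuPart
  Summit.BirchSwinnertonDyer.Rank1Residual.X1.ParitySqueeze
  Summit.BirchSwinnertonDyer.Rank1Residual.X1.TamagawaSqueeze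

namespace Summit.BirchSwinnertonDyer.Rank1Residual.X2

/-! ## Route T with the EXACT value: Mazur's main conjecture at `(E₀, p)` -/

section RouteT

variable {W : WeierstrassCurve ℚ} [W.IsElliptic] [W.IsGloballyMinimal] {p : ℕ} [Fact p.Prime]

/-- **Mazur's main conjecture at an odd multiplicative Eisenstein prime from the EXACT algebraic
invariants (no parity, no rank hypothesis).** `μ_an = 0` (`AnalyticMuLE W p 0`), `λ_an = n`
(`AnalyticLambdaEq W p n`, trivial zero included), `(μ_alg, λ_alg) = (0, k)`
(`AlgebraicInvariantsEq W p k` — per pair by route G), and `n ≤ k` at a non-split prime / `n ≤ k + 1`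
at a split prime (by `add_le_of_algebraicInvariantsEq_of_analyticLambdaEq` this forces equality) ⇒
`X2.MazurMainConjectureAt W p`: with Wuthrich's `ϖ·L = ι(T^e·h·f_E)`, `char X = (f_E)` (Thm. 16,
`hWu`), `n = e + λ(h) + λ(f_E) = e + λ(h) + k ≥ n + λ(h)`, so `λ(h) = 0 = μ(h)` and `h ∈ Λˣ`.
[cite: Wuthrich2014, Thm. 16 and §5 (p. 397)] [cite: GreenbergVatsal2000, p. 4 (after Thm. (1.2)) and §2 p. 27] -/
theorem mazurMainConjectureAt_of_algebraicInvariantsEq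
    (hWu : thm16_charIdeal_dvd_multiplicative_of_reducible)
    (W : WeierstrassCurve ℚ) [W.IsElliptic] [W.IsGloballyMinimal] (p : ℕ) [Fact p.Prime]
    (hp2 : p ≠ 2) (hmult : W.HasMultiplicativeReductionAtPrime p)
    (hred : ¬ W.HasIrreducibleModPGaloisRep p) {n k : ℕ}
    (hμ0 : AnalyticMuLE W p 0) (hlam : AnalyticLambdaEq W p n) (hinv : AlgebraicInvariantsEq W p k)
    (hkN : ¬ W.HasSplitMultiplicativeReductionAtPrime p → n ≤ k)
    (hkS : W.HasSplitMultiplicativeReductionAtPrime p → n ≤ k + 1) :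
    X2.MazurMainConjectureAt W p := by
  intro κ γ hκ hγ hγ' N _ f hf D ϖ hϖ
  haveI : Module.Finite (IwasawaAlgebra p) D.X := D.module_finite_holds hγ
  -- Wuthrich Thm. 16 at this datum; a generator `fE` of the characteristic ideal
  obtain ⟨hX, hKns, hKs⟩ := hWu W p hp2 hmult hred hκ hγ hγ' hf D ϖ hϖ
  obtain ⟨fE, hfE⟩ := (charIdeal_isPrincipal_holds p D.X).principal
  have hchar : D.charIdeal = Ideal.span {fE} := hfE
  -- the exact value: `λ(fE) = λ(X) = k` once `fE ≠ 0`
  have hkfE : fE ≠ 0 → k ≤ lam fE := fun hfE0 ↦ by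
    rw [lam_generator_eq_lambdaInvariant D.X hX hfE0 hchar, (hinv κ γ hκ hγ hγ' D).2.2]
  -- how the analytic certificates at `G = u · (h · fE)` finish
  have finish : ∀ (u h g : IwasawaAlgebra p) (e : ℕ) (L : PowerSeries ℚ_[p]), u ≠ 0 → lam u = e →
      h * fE = g → iwasawaToPowerSeries p (u * (h * fE)) = PowerSeries.C ((ϖ : ℚ) : ℚ_[p]) * L →
      (∃ k' : ℕ, (p : ℝ) ^ (-(((0 : ℕ) : ℤ) + 1)) <
        ‖PowerSeries.coeff k' (PowerSeries.C ((ϖ : ℚ) : ℚ_[p]) * L)‖) →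
      lam (u * (h * fE)) = n → n ≤ k + e → IsUnit h := by
    intro u h g e L hu0 hlu hgh hG hμ hlG hnk
    obtain ⟨k', hk'⟩ := hμ
    have hL0 : PowerSeries.C ((ϖ : ℚ) : ℚ_[p]) * L ≠ 0 := ne_zero_of_lt_norm_coeff hk'
    have hG0 : u * (h * fE) ≠ 0 := by
      intro h0; apply hL0; rw [← hG, h0, map_zero]
    have hh0 : h ≠ 0 := fun h0 ↦ hG0 (by rw [h0, zero_mul, mul_zero])
    have hfE0 : fE ≠ 0 := fun h0 ↦ hG0 (by rw [h0, mul_zero, mul_zero])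
    rw [← hG] at hk'
    have hμG : mu (u * (h * fE)) = 0 := Nat.le_zero.mp (mu_le_of_lt_norm_coeff hk')
    exact (isUnit_of_lam_mul_mul_eq_of_ge hu0 hh0 hfE0 hlu hμG hlG (hkfE hfE0) hnk).1
  refine ⟨hX, fE, hchar, fun hsplit L hL => ?_, fun hns L hL => ?_⟩
  · -- SPLIT `p`: `ι(T · g) = ϖ · L`, `g = h · fE`, `λ(T·h·fE) = n ≤ k + 1`
    obtain ⟨g, hgmem, hιg⟩ := hKs hsplit L hL
    have hgmem' : g ∈ Ideal.span {fE} := by rw [← hchar]; exact hgmem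
    obtain ⟨h, hgh⟩ := Ideal.mem_span_singleton'.mp hgmem'
    have hG : iwasawaToPowerSeries p (PowerSeries.X * (h * fE)) =
        PowerSeries.C ((ϖ : ℚ) : ℚ_[p]) * L := by rw [hgh]; exact hιg
    have hlG : lam (PowerSeries.X * (h * fE)) = n :=
      hlam f hf ϖ hϖ L (fun _ ↦ hL) (fun hns ↦ absurd hsplit hns) _ hG
    have hunit : IsUnit h := finish PowerSeries.X h g 1 L PowerSeries.X_ne_zero lam_X hgh hG
      (hμ0 f hf ϖ hϖ L (fun _ ↦ hL) (fun hns ↦ absurd hsplit hns)) hlG (hkS hsplit)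
    refine ⟨hunit.unit, ?_⟩
    rw [IsUnit.unit_spec, show (PowerSeries.X : IwasawaAlgebra p) * fE * h = PowerSeries.X * g by
      rw [← hgh]; ring]
    exact hιg
  · -- NON-SPLIT `p`: `ι(g) = ϖ · L`, `g = h · fE`, `λ(1·h·fE) = n ≤ k`
    obtain ⟨g, hgmem, hιg⟩ := hKns hns L hL
    have hgmem' : g ∈ Ideal.span {fE} := by rw [← hchar]; exact hgmem
    obtain ⟨h, hgh⟩ := Ideal.mem_span_singleton'.mp hgmem'
    have hG : iwasawaToPowerSeries p (1 * (h * fE)) = PowerSeries.C ((ϖ : ℚ) : ℚ_[p]) * L := by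
      rw [one_mul, hgh]; exact hιg
    have hlG : lam (1 * (h * fE)) = n :=
      hlam f hf ϖ hϖ L (fun hsplit ↦ absurd hsplit hns) (fun _ ↦ hL) _ hG
    have hunit : IsUnit h := finish 1 h g 0 L one_ne_zero (lam_eq_zero_of_isUnit isUnit_one) hgh hG
      (hμ0 f hf ϖ hϖ L (fun hsplit ↦ absurd hsplit hns) (fun _ ↦ hL)) hlG
      (by simpa using hkN hns)
    refine ⟨hunit.unit, ?_⟩
    rw [IsUnit.unit_spec, show fE * h = g by rw [← hgh]; ring]
    exact hιg

/-- **Consistency (Kato–Wuthrich direction): `λ_alg + e_p ≤ λ_an` at `p ‖ N`.** If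
`AlgebraicInvariantsEq W p k`, `AnalyticLambdaEq W p n` and `AnalyticMuLE W p m` (any `m`; it makes
`ϖ·L ≠ 0`) at an odd multiplicative Eisenstein prime, then `k ≤ n` at a non-split prime and
`k + 1 ≤ n` at a split prime (the data exist: modularity `hpar`, THE multiplicative `p`-adic
`L`-function by the tree's existence theorems, the cyclotomic `κ, γ`, a dual datum; then
`n = e + λ(h) + λ(f_E) = e + λ(h) + k`). So a transferred value `k + e_p > λ_an` REFUTES one of the
inputs, and `k + e_p < λ_an` says Mazur's main conjecture FAILS at the pair unless an input is wrong —
the census's falsification test in the kernel. [cite: Wuthrich2014, Thm. 16 (p. 397)]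
[cite: GreenbergVatsal2000, §2 p. 27] -/
theorem add_le_of_algebraicInvariantsEq_of_analyticLambdaEq
    (hWu : thm16_charIdeal_dvd_multiplicative_of_reducible)
    (hpar : nonempty_modularParametrizationData)
    (W : WeierstrassCurve ℚ) [W.IsElliptic] [W.IsGloballyMinimal] (p : ℕ) [Fact p.Prime]
    (hp2 : p ≠ 2) (hmult : W.HasMultiplicativeReductionAtPrime p)
    (hred : ¬ W.HasIrreducibleModPGaloisRep p) {n k m : ℕ}
    (hμ : AnalyticMuLE W p m) (hlam : AnalyticLambdaEq W p n) (hinv : AlgebraicInvariantsEq W p k) :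
    (¬ W.HasSplitMultiplicativeReductionAtPrime p → k ≤ n) ∧
      (W.HasSplitMultiplicativeReductionAtPrime p → k + 1 ≤ n) := by
  haveI : NeZero (W.conductorNorm ℤ) := ⟨(W.conductorNorm_pos_holds).ne'⟩
  obtain ⟨Dm⟩ := hpar W
  have hf : IsNewformOf W Dm.f := Dm.isNewformOf
  obtain ⟨ϖ, -, hϖeq, -⟩ := Dm.exists_rat_mul_realPeriodRat_eq_plusPeriod
  obtain ⟨κ, hκ, γ, hγ, hγ'⟩ := exists_isCyclotomic_isTopGenerator_isCyclotomicVariable_holds p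
  obtain ⟨D⟩ := W.nonempty_selmerDualData_holds κ γ hγ
  haveI : Module.Finite (IwasawaAlgebra p) D.X := D.module_finite_holds hγ
  obtain ⟨hXt, hKns, hKs⟩ := hWu W p hp2 hmult hred hκ hγ hγ' hf D ϖ hϖeq
  obtain ⟨fE, hchar⟩ := (charIdeal_isPrincipal_holds p D.X).principal
  have hchar' : D.charIdeal = Ideal.span {fE} := hchar
  have hlamX : lambdaInvariant p D.X = k := (hinv κ γ hκ hγ hγ' D).2.2
  -- the count at `G = u · (h · fE)`, `λ(u) = e`
  have count : ∀ (u h : IwasawaAlgebra p) (e : ℕ) (L : PowerSeries ℚ_[p]), u ≠ 0 → lam u = e →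
      iwasawaToPowerSeries p (u * (h * fE)) = PowerSeries.C ((ϖ : ℚ) : ℚ_[p]) * L →
      (∃ k' : ℕ, (p : ℝ) ^ (-((m : ℤ) + 1)) <
        ‖PowerSeries.coeff k' (PowerSeries.C ((ϖ : ℚ) : ℚ_[p]) * L)‖) →
      lam (u * (h * fE)) = n → k + e ≤ n := by
    intro u h e L hu0 hlu hG hμ' hlG
    obtain ⟨k', hk'⟩ := hμ'
    have hL0 : PowerSeries.C ((ϖ : ℚ) : ℚ_[p]) * L ≠ 0 := ne_zero_of_lt_norm_coeff hk'
    have hG0 : u * (h * fE) ≠ 0 := by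
      intro h0; apply hL0; rw [← hG, h0, map_zero]
    have hh0 : h ≠ 0 := fun h0 ↦ hG0 (by rw [h0, zero_mul, mul_zero])
    have hfE0 : fE ≠ 0 := fun h0 ↦ hG0 (by rw [h0, mul_zero, mul_zero])
    have h2 : lam fE = k := (lam_generator_eq_lambdaInvariant D.X hXt hfE0 hchar').trans hlamX
    rw [lam_mul hu0 (mul_ne_zero hh0 hfE0), lam_mul hh0 hfE0, hlu] at hlG
    omega
  constructor
  · intro hns
    obtain ⟨L, hL⟩ := exists_isMultPAdicLFunctionOf_neg_one_of_nonsplit hf hmult hns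
    obtain ⟨g, hgmem, hιg⟩ := hKns hns L hL
    have hgmem' : g ∈ Ideal.span {fE} := by rw [← hchar']; exact hgmem
    obtain ⟨h, hgh⟩ := Ideal.mem_span_singleton'.mp hgmem'
    have hG : iwasawaToPowerSeries p (1 * (h * fE)) = PowerSeries.C ((ϖ : ℚ) : ℚ_[p]) * L := by
      rw [one_mul, hgh]; exact hιg
    have hlG : lam (1 * (h * fE)) = n :=
      hlam Dm.f hf ϖ hϖeq L (fun hsplit ↦ absurd hsplit hns) (fun _ ↦ hL) _ hG
    have := count 1 h 0 L one_ne_zero (lam_eq_zero_of_isUnit isUnit_one) hG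
      (hμ Dm.f hf ϖ hϖeq L (fun hsplit ↦ absurd hsplit hns) (fun _ ↦ hL)) hlG
    omega
  · intro hsplit
    obtain ⟨L, hL⟩ := exists_isSplitMultPAdicLFunctionOf hsplit hf
    obtain ⟨g, hgmem, hιg⟩ := hKs hsplit L hL
    have hgmem' : g ∈ Ideal.span {fE} := by rw [← hchar']; exact hgmem
    obtain ⟨h, hgh⟩ := Ideal.mem_span_singleton'.mp hgmem'
    have hG : iwasawaToPowerSeries p (PowerSeries.X * (h * fE)) =
        PowerSeries.C ((ϖ : ℚ) : ℚ_[p]) * L := by rw [hgh]; exact hιg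
    have hlG : lam (PowerSeries.X * (h * fE)) = n :=
      hlam Dm.f hf ϖ hϖeq L (fun _ ↦ hL) (fun hns ↦ absurd hsplit hns) _ hG
    exact count PowerSeries.X h 1 L PowerSeries.X_ne_zero lam_X hG
      (hμ Dm.f hf ϖ hϖeq L (fun _ ↦ hL) (fun hns ↦ absurd hsplit hns)) hlG

/-- **The closing case is an EQUALITY.** Under the hypotheses of
`mazurMainConjectureAt_of_algebraicInvariantsEq` (with modularity `hpar` to instantiate the
consistency), `n = k` at a non-split prime and `n = k + 1` at a split prime. [cite: Wuthrich2014, Thm. 16 (p. 397)] -/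
theorem eq_of_algebraicInvariantsEq_of_le
    (hWu : thm16_charIdeal_dvd_multiplicative_of_reducible)
    (hpar : nonempty_modularParametrizationData)
    (W : WeierstrassCurve ℚ) [W.IsElliptic] [W.IsGloballyMinimal] (p : ℕ) [Fact p.Prime]
    (hp2 : p ≠ 2) (hmult : W.HasMultiplicativeReductionAtPrime p)
    (hred : ¬ W.HasIrreducibleModPGaloisRep p) {n k : ℕ}
    (hμ0 : AnalyticMuLE W p 0) (hlam : AnalyticLambdaEq W p n) (hinv : AlgebraicInvariantsEq W p k)
    (hkN : ¬ W.HasSplitMultiplicativeReductionAtPrime p → n ≤ k)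
    (hkS : W.HasSplitMultiplicativeReductionAtPrime p → n ≤ k + 1) :
    (¬ W.HasSplitMultiplicativeReductionAtPrime p → n = k) ∧
      (W.HasSplitMultiplicativeReductionAtPrime p → n = k + 1) := by
  obtain ⟨hN, hS⟩ :=
    add_le_of_algebraicInvariantsEq_of_analyticLambdaEq hWu hpar W p hp2 hmult hred hμ0 hlam hinv
  exact ⟨fun hns ↦ le_antisymm (hkN hns) (hN hns), fun hs ↦ le_antisymm (hkS hs) (hS hs)⟩

end RouteT

end Summit.BirchSwinnertonDyer.Rank1Residual.X2

end
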